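import Summits.BirchSwinnertonDyer.BirchSwinnertonDyer.Theses.SemiOrdinaryEisensteinDescent
import Summits.BirchSwinnertonDyer.BirchSwinnertonDyer.Theorems.SemiOrdinaryEisensteinDescentWildKolyvaginUpperAtThreeOfMinftyGe
import Summits.BirchSwinnertonDyer.BirchSwinnertonDyer.Theorems.WildThreeRankOneBSDpOfGlobalDivisibilityStepL
import Literature.NumberTheory.EllipticCurves.MatarNekovar2019.ShaStructureIrreducible
import HarnessLib

/-!
# Route `SemiOrdinaryEisensteinDescent`, crux Ko `WildKolyvaginUpperAtThree` (stmt-BirchSwinnertonDyer-20480): the split child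
# J `WildSigmaDivisibilityAtThree` (stmt-…-20760) is NOT STRONGER than Ko modulo print — `Ko ⟹ J` from Kolyvagin 1990 +
# Matar–Nekovář 2019 Thm. 0.7 (LOWER half) —, and J BY NAME from the line's class-currency stub `stub_minftyGeManin`
# (lead prover `bsd-wall-soed-p2` g0, line `birth`; `--supports stmt-BirchSwinnertonDyer-20480`; BSD is not proved by any of this)

WHAT IS PROVED (sorry-free; named facts appear only as displayed hypotheses).

* `wildSigmaDivisibilityAtThree_of_wildKolyvaginUpperAtThree` — **Ko ⟹ J modulo print.** The steward's split of Ko is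
  {J = Σ-form global divisibility of the derived Heegner points (crux 20760), the two named facts (support 20761), glue 20762 ✓
  (J → inputs → Ko, p544141)}. CONVERSELY: given Kolyvagin 1990 Thm. A (`kolyvagin`, named) and the LOWER half of Kolyvagin's
  structure theorem under irreducibility (Matar–Nekovář 2019 Thm. 0.7/§0.11, `MatarNekovar2019.thm07_pow_dvd_card_sha_primary_of_certificate_of_irreducible`,
  named: ONE derived point `P(n) ∉ 3^{M+1} E(K[n])` at Zhang–Kolyvagin primes of index `≥ M+1` forces `3^{2(M₀−M)} ∣ #Ш(E/K)[3^∞]`),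
  the crux Ko (co-STEP L at slack `v₃ c`: `ord₃ #Ш(E/K) + 2·ord₃ ∏ c_q + 2·v₃ c ≤ 2·ord₃ [E(K):ℤP]`) IMPLIES J: a certificate at
  depth `s' ≤ ord₃ ∏ c_q + v₃ c` would give `ord₃ #Ш(E/K) ≥ 2(M₀ − s' + 1) > 2M₀ − 2(ord₃ ∏ c_q + v₃ c)`, contradicting Ko
  (`M₀ = ord₃ [E(K):ℤP]` by McCallum Lemma 5.1 in the tree's bookkeeping `Koly.padicValNat_index_zmultiples_eq_of_divisibility`,
  rank one and `Ш(E/K)` finite from `kolyvagin`, `E(K)[3] = 0` from `ρ̄_{E,3}` onto). So J ⟺ Ko MODULO PRINT: the split loses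
  nothing and adds nothing but the two published theorems.
* `wildSigmaDivisibilityAtThree_of_minftyGeManin` — **J BY NAME from `stub_minftyGeManin`** (line `birth`, class currency,
  registered verbatim), UNCONDITIONALLY, through the CLASS ⟹ POINT bridge `WildKolyvaginUpperAtThreeOfMinftyGe.globalDivisibility_of_minftyGe`
  (p567352): whoever proves the line's research stub closes the child crux J by `exact`.

References: [MatarNekovar2019] Thm. 0.7 (p. 456), §0.11 (p. 457); [McCallumLMS1991] §5 Lemma 5.1, Cor. 5.6 (p. 310);
[Jetchev2008] Conj. 1.3, Cor. 1.5 (p. 812); [GrossLMS1991] §1 Thm. 1.3, §4 Lemma 4.3.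
-/

set_option autoImplicit false
set_option linter.dupNamespace false -- `Summit.BirchSwinnertonDyer.BirchSwinnertonDyer.…` is the tree's layout (D-0017)

noncomputable section

open scoped Classical

namespace Summit.BirchSwinnertonDyer.BirchSwinnertonDyer.Theorems.WildSigmaDivisibilityAtThreeOfKo

open WeierstrassCurve NumberField Field IsDedekindDomain Literature.NumberTheory.EllipticCurves
  Literature.NumberTheory.EllipticCurves.ModularForms
  Literature.NumberTheory.EllipticCurves.Rank1Residual
  Summit.BirchSwinnertonDyer.Rank1Residual
  Summit.BirchSwinnertonDyer.Rank1Residual.Additive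
  Summit.BirchSwinnertonDyer.Rank1Residual.X11b
  Summit.BirchSwinnertonDyer.Rank1Residual.X11b.Three
  Summit.BirchSwinnertonDyer.BirchSwinnertonDyer.Theses.SemiOrdinaryEisensteinDescent
  Summit.BirchSwinnertonDyer.BirchSwinnertonDyer.Theorems.SchneiderFree

/-- **The socket at one frame ⟹ global divisibility to the same depth (point currency), modulo print.** For `W/ℚ` globally
minimal elliptic, `ρ̄_{E,3}` onto, `K` imaginary quadratic Heegner for `N_E` with `d_K ∉ {−3, −4}`, a frame `(Dt, H, ι)` and
`P ∈ E(K)` with `ι(P) = heegnerPointComplex Dt H` of infinite order: if `Upper.IndexUpperBoundLeAt W 3 K P s`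
(`ord₃ #Ш(E/K) + 2·ord₃ ∏ c_q + 2s ≤ 2·ord₃[E(K):ℤP]`) then every derived Heegner point `P(n)` on the frame `(Dt, H.β, ι)` at a
square-free product of Zhang–Kolyvagin primes of index `≥ s'`, `s' ≤ ord₃ ∏ c_q + s`, is `3^{s'}`-divisible in `E(K[n])`.
CONDITIONAL on `kolyvagin` (Kolyvagin 1990 Thm. A) and the LOWER half of the structure theorem
`MatarNekovar2019.thm07_pow_dvd_card_sha_primary_of_certificate_of_irreducible`, taken as hypotheses.
[cite: MatarNekovar2019, Thm. 0.7 (p. 456) and §0.11 (p. 457)] [cite: McCallumLMS1991, §5 Lemma 5.1 and Cor. 5.6 (p. 310)] -/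
theorem globalDivisibility_of_upper_of_surj
    (hKo : ∀ (N : ℕ) [NeZero N] (W : WeierstrassCurve ℚ) (K : Type) [Field K] [NumberField K],
      kolyvagin N W K)
    (hMNlow : MatarNekovar2019.thm07_pow_dvd_card_sha_primary_of_certificate_of_irreducible)
    (W : WeierstrassCurve ℚ) [W.IsElliptic] [W.IsGloballyMinimal] [NeZero (W.conductorNorm ℤ)]
    (hsurj : W.HasSurjectiveModNGaloisRep 3)
    (K : Type) [Field K] [NumberField K] (hK : IsImaginaryQuadratic K)
    (h3 : NumberField.discr K ≠ -3) (h4 : NumberField.discr K ≠ -4)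
    (hHH : SatisfiesHeegnerHypothesis (W.conductorNorm ℤ) K)
    (Dt : ModularParametrizationData W (W.conductorNorm ℤ))
    (H : HeegnerDatum (W.conductorNorm ℤ) (NumberField.discr K)) (ι : K →+* ℂ)
    (P : (W.baseChange K).toAffine.Point)
    (hP : WeierstrassCurve.Affine.Point.map ι.toRatAlgHom P = heegnerPointComplex Dt H)
    (hnt : ¬ IsOfFinAddOrder P) {s : ℕ} (hup : Upper.IndexUpperBoundLeAt W 3 K P s) :
    ∀ (s' : ℕ), s' ≤ padicValNat 3 W.tamagawaProduct + s →
      ∀ (n : ℕ) (d : KolyvaginHeegnerData Dt H.β ι n), Squarefree n →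
        (∀ ℓ ∈ n.primeFactors, Zhang2014.IsKolyvaginPrime (W.conductorNorm ℤ) W K 3 ℓ ∧
          s' ≤ Zhang2014.kolyvaginIndex W 3 ℓ) → Koly.PDiv d 3 s' := by
  intro s' hs' n d hn hkol
  haveI : Fact (Nat.Prime 3) := ⟨Nat.prime_three⟩
  by_cases hs0 : s' = 0
  · subst hs0
    exact ⟨d.derivedPoint, by rw [pow_zero, Nat.cast_one, one_zsmul]⟩
  obtain ⟨M, rfl⟩ : ∃ M, s' = M + 1 := ⟨s' - 1, by omega⟩
  by_contra hcert
  -- standing inputs: non-CM and irreducible from `ρ̄_{E,3}` onto; rank one and `Ш(E/K)` finite from Kolyvagin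
  have hCM : ¬ W.HasCM := fun hCM ↦ W.not_hasSurjectiveModNGaloisRep_of_hasCM hCM Nat.prime_three (by norm_num) hsurj
  have hirr : W.HasIrreducibleModPGaloisRep 3 :=
    hasIrreducibleModPGaloisRep_of_hasSurjectiveModNGaloisRep W 3 hsurj
  obtain ⟨hrank, hfin⟩ := hKo (W.conductorNorm ℤ) W K hK hHH ⟨Dt, H, ι, hP⟩ hnt
  haveI : Finite (W.baseChange K).sha := hfin
  have hbot := torsionBy_eq_bot_of_isImaginaryQuadratic_of_hasIrreducibleModPGaloisRep W K hK Nat.prime_three hirr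
  have hiv : ∀ x : (W.baseChange K).toAffine.Point, 3 • x = 0 → x = 0 := fun x hx ↦ by
    have hmem : x ∈ AddSubgroup.torsionBy (W.baseChange K).toAffine.Point ((3 : ℕ) : ℤ) := by
      rw [mem_torsionBy_iff, natCast_zsmul]
      exact hx
    rw [hbot] at hmem
    exact hmem
  -- the conductor-`1` datum and `P(1) ↦ P` (Darmon Thm. 3.6 and Shimura reciprocity at conductor `1`, discharged)
  obtain ⟨d₁⟩ := exists_kolyvaginHeegnerData_one
    (phi_heegnerTau_mem_singularModuliField_holds (W.conductorNorm ℤ) W K) hK Dt H.β ι H.dvd_sq_sub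
  have hPd : d₁.toGeomPoints d₁.derivedPoint = toGeomPoints (W.baseChange K) P :=
    KolyvaginBottom.toGeomPoints_derivedPoint_one_eq
      (heegnerPointOfConductor_one_galoisConj_holds (W.conductorNorm ℤ) W K) hK hHH hP d₁ rfl
  -- `3^{M₀} ∥ P` in `E(K)`
  haveI : Module.Finite ℤ (W.baseChange K).toAffine.Point := (W.baseChange K).module_finite_point_holds
  obtain ⟨M₀, x₀, hx₀, hmax⟩ := exists_pow_smul_eq_and_forall_ne hnt (p := 3) (by norm_num)
  have hdiv : ∃ Q : (W.baseChange K).toAffine.Point, ((3 ^ M₀ : ℕ) : ℤ) • Q = P :=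
    ⟨x₀, by rw [natCast_zsmul]; exact hx₀⟩
  have hndiv : ¬ ∃ Q : (W.baseChange K).toAffine.Point, ((3 ^ (M₀ + 1) : ℕ) : ℤ) • Q = P := by
    rintro ⟨Q, hQ⟩
    exact hmax Q (by rw [← natCast_zsmul]; exact hQ)
  -- the certificate forces `3^{2(M₀ − M)} ∣ #Ш(E/K)[3^∞]` (structure theorem, lower half)
  have hdvd := hMNlow W hCM K hK h3 h4 hHH 3 (by decide) hirr Dt H.β ι d₁ P hPd hnt M₀ hdiv hndiv n M d hn hkol hcert
  haveI : Finite (AddCommGroup.primaryComponent (W.baseChange K).sha 3) := inferInstance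
  have hcard : Nat.card (AddCommGroup.primaryComponent (W.baseChange K).sha 3) ≠ 0 := Nat.card_pos.ne'
  have hle : 2 * (M₀ - M) ≤ padicValNat 3 (Nat.card (AddCommGroup.primaryComponent (W.baseChange K).sha 3)) :=
    (padicValNat_dvd_iff_le hcard).mp hdvd
  -- bookkeeping: `ord₃ #Ш(E/K) = ord₃ #Ш(E/K)[3^∞]`, `ord₃ [E(K):ℤP] = M₀`
  have hsha : padicValNat 3 (W.baseChange K).shaOrder =
      padicValNat 3 (Nat.card (AddCommGroup.primaryComponent (W.baseChange K).sha 3)) :=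
    Koly.padicValNat_shaOrder_eq (W.baseChange K) 3
  haveI : Finite (AddCommGroup.torsion (W.baseChange K).toAffine.Point) :=
    WeierstrassCurve.finite_torsion_point (W := W.baseChange K)
  obtain ⟨c, Q, hcQ, hcker⟩ := RankOne.exists_coord_of_mordellWeilRank_eq_one (W.baseChange K) hrank
  have hidx : padicValNat 3 (AddSubgroup.zmultiples P).index = M₀ :=
    Koly.padicValNat_index_zmultiples_eq_of_divisibility c Q hcQ hcker hiv P hdiv hndiv
  unfold Upper.IndexUpperBoundLeAt at hup
  rw [hidx, hsha] at hup
  omega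

/-- **Ko ⟹ J modulo print: the split child `WildSigmaDivisibilityAtThree` (crux 20760) follows from the parent crux
`WildKolyvaginUpperAtThree` BY NAME, given Kolyvagin 1990 Thm. A and Matar–Nekovář 2019 Thm. 0.7 (lower half).** With the glue
20762 (J → inputs → Ko, closed, p544141) this makes J ⟺ Ko MODULO the published structure theorem (both halves) and Kolyvagin:
the split isolates exactly the research content. CONDITIONAL on `hKo`, `hMNlow`; nothing is asserted about any curve.
[cite: MatarNekovar2019, Thm. 0.7 (p. 456) and §0.11 (p. 457)] [cite: Jetchev2008, Conj. 1.3 and Cor. 1.5 (p. 812)] -/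
theorem wildSigmaDivisibilityAtThree_of_wildKolyvaginUpperAtThree
    (hKo : ∀ (N : ℕ) [NeZero N] (W : WeierstrassCurve ℚ) (K : Type) [Field K] [NumberField K],
      kolyvagin N W K)
    (hMNlow : MatarNekovar2019.thm07_pow_dvd_card_sha_primary_of_certificate_of_irreducible)
    (hUp : WildKolyvaginUpperAtThree) : WildSigmaDivisibilityAtThree := by
  intro W _ _ N _ K _ _ Dt H ι P hO6 hsurj hr hN hK hHH hLd hP hnt hodd h3 htower s' hs' n d hn hkol
  have hup := hUp W N K Dt H ι P hO6 hsurj hr hN hK hHH hLd hP hnt hodd h3 htower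
  subst hN
  have h4 : NumberField.discr K ≠ -4 := by
    intro h
    rw [h] at hodd
    exact (Int.not_odd_iff_even.mpr ⟨-2, by norm_num⟩) hodd
  exact globalDivisibility_of_upper_of_surj hKo hMNlow W hsurj K hK h3 h4 hHH Dt H ι P hP hnt hup s' hs' n d hn hkol

/-- **J BY NAME from the line's class-currency research stub, UNCONDITIONALLY.** `stub_minftyGeManin` (line `birth`,
registered: `AdditiveThree.MinftyGe W K Dt H.β ι (ord₃ ∏ c_q + v₃ c)` on Ko's binders) implies the child crux
`WildSigmaDivisibilityAtThree` through the CLASS ⟹ POINT bridge `WildKolyvaginUpperAtThreeOfMinftyGe.globalDivisibility_of_minftyGe`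
(p567352; `d_K < −4` from `d_K` odd, `d_K ≠ −3` and the orientation). No named fact. [cite: McCallumLMS1991, §4 Cor. 4.5]
[cite: WZhang2014, §3.8] -/
theorem wildSigmaDivisibilityAtThree_of_minftyGeManin
    (hM : ∀ (W : WeierstrassCurve ℚ) [W.IsElliptic] [W.IsGloballyMinimal],
      Summit.BirchSwinnertonDyer.Rank1Residual.Additive.ClassO6 W 3 → W.HasSurjectiveModNGaloisRep 3 →
      W.analyticRank = 1 → Summit.BirchSwinnertonDyer.Rank1Residual.AdditiveThree.TowerSurjThree W →
      ∀ (K : Type) [Field K] [NumberField K], Literature.NumberTheory.EllipticCurves.IsImaginaryQuadratic K →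
      Odd (NumberField.discr K) → NumberField.discr K ≠ -3 → ∀ [NeZero (W.conductorNorm ℤ)],
      Literature.NumberTheory.EllipticCurves.SatisfiesHeegnerHypothesis (W.conductorNorm ℤ) K →
      (W.quadraticTwist (NumberField.discr K : ℚ)).entireLFunction 1 ≠ 0 →
      ∀ (Dt : Literature.NumberTheory.EllipticCurves.ModularForms.ModularParametrizationData W (W.conductorNorm ℤ))
        (H : Literature.NumberTheory.EllipticCurves.HeegnerDatum (W.conductorNorm ℤ) (NumberField.discr K))
        (ι : K →+* ℂ) (P : (W.baseChange K).toAffine.Point),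
      (WeierstrassCurve.Affine.Point.map ι.toRatAlgHom) P =
        Literature.NumberTheory.EllipticCurves.ModularForms.heegnerPointComplex Dt H →
      ¬ IsOfFinAddOrder P →
      Summit.BirchSwinnertonDyer.Rank1Residual.AdditiveThree.MinftyGe W K Dt H.β ι
        (padicValNat 3 W.tamagawaProduct + padicValNat 3 Dt.c.natAbs)) :
    WildSigmaDivisibilityAtThree := by
  intro W _ _ N _ K _ _ Dt H ι P hO6 hsurj hr hN hK hHH hLd hP hnt hodd h3 htower s' hs' n d hn hkol
  subst hN
  have hD : NumberField.discr K < -4 :=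
    WildKolyvaginUpperAtThreeOfMinftyGe.discr_lt_neg_four_of_odd hK hodd h3 H.dvd_sq_sub
  exact WildKolyvaginUpperAtThreeOfMinftyGe.globalDivisibility_of_minftyGe W K hK hHH hD hsurj Dt H.β ι
    (hM W hO6 hsurj hr htower K hK hodd h3 hHH hLd Dt H ι P hP hnt) s' hs' n d hn hkol

end Summit.BirchSwinnertonDyer.BirchSwinnertonDyer.Theorems.WildSigmaDivisibilityAtThreeOfKo

end
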